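import Mathlib.GroupTheory.Perm.Cycle.Type
import Mathlib.Data.ZMod.Basic
import Mathlib.Data.Matrix.Mul
import HarnessLib

/-!
# Crux `Capture` (stmt-PneNP-2659) — SIGN CERTIFICATES for the dual-PERM door: definitions

Objects of the positive theorems `signTest_sound` (`ConvexRankGatesCaptureSignCert.lean`) and `signTest_circuit`
(`ConvexRankGatesCaptureSignCertGate.lean`), lead c10. Context: the duality audit of the crux (lead c7,
`Cruxes/Capture/DUALITY-AUDIT-c7.md`) left ONE structurally open cell, the crux's named load-bearing prediction
`DualPerm`: `Z ↦ [τ ∉ ⟨σ_i : i ∉ Z⟩]` (non-membership in the group generated by the UNselected permutations) should be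
a polynomial extended circuit. Orbit / block tests (c7: `orbitSplit_circuit`, complete for groups of bounded
closure number) are blind to ALTERNATING sections — the "hidden sign character". This vocabulary makes the sign
character a MONOTONE, `𝔽₂`-LINEAR certificate:

* `onB x g hx` — an `x`-invariant permutation `g` (`x : Fin d → 𝔽₂` a 2-colouring of the points) restricted to the
  class `B = {x = 1}` and extended by the identity; `certSubgroup x` — the `x`-invariant permutations EVEN on `B`.
* `sgnRow g = 𝟙_{supp g} + Σ_{cycles c of g} e_{min c}` (`cycRow`): for `x`-invariant `g`, `sgnRow g ⬝ᵥ x` is the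
  parity of `|supp g ∩ B| + #{cycles inside B}`, i.e. the SIGN of `g` on `B` — linear in `x`.
* `SignTest σ τ v` — the level-1 sign test: `∃ x`, invariant under `τ` and all remaining `σ_i` (`v i = false`),
  with `sgnRow τ ⬝ᵥ x = 1` and `sgnRow σ_i ⬝ᵥ x = 0`: an `𝔽₂`-affine system whose equations are indexed by the OFF
  wires (`wrow`) plus constants (`crow`) — hence a DUAL SPAN program, hence ONE PERM gate (Gál duality, c7's
  `dualSpan_onePermGate`).

This file only fixes the vocabulary; `onB_apply` is the registered anchor. [folklore]
-/

namespace Summit.PneNP.PneNP.Theorems.Capture.SignCert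

set_option linter.dupNamespace false -- `Summit.PneNP.PneNP.…`: summit = sub-problem (D-0017)

open Equiv Equiv.Perm Finset

variable {d : ℕ}

/-! ### Restriction of an `x`-invariant permutation to the class `B = {x = 1}` -/

/-- For a colouring `x : Fin d → 𝔽₂` and an `x`-invariant permutation `g`, the permutation `onB x g _`
agrees with `g` on `B = {p | x p = 1}` and is the identity off `B`. [folklore] -/
def onB (x : Fin d → ZMod 2) (g : Perm (Fin d)) (hx : ∀ p, x (g p) = x p) : Perm (Fin d) :=
  ofSubtype (g.subtypePerm (p := fun p => x p = 1) (fun p => by rw [hx]))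

/-- **`onB` pointwise** (registered anchor `onB_apply`): `g` on `B = {x = 1}`, identity off `B`. [folklore] -/
theorem onB_apply : ∀ {d : ℕ} (x : Fin d → ZMod 2) (g : Equiv.Perm (Fin d)) (hx : ∀ p, x (g p) = x p) (p : Fin d),
    onB x g hx p = if x p = 1 then g p else p := by
  intro d x g hx p
  unfold onB
  split_ifs with h
  · exact ofSubtype_subtypePerm_of_mem _ h
  · exact ofSubtype_subtypePerm_of_not_mem _ h

/-- `onB` of the identity is the identity. [folklore] -/
theorem onB_one (x : Fin d → ZMod 2) : onB x 1 (fun _ => rfl) = 1 := by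
  ext p
  rw [onB_apply]
  split_ifs <;> rfl

/-- `onB` is multiplicative on `x`-invariant permutations. [folklore] -/
theorem onB_mul (x : Fin d → ZMod 2) (g h : Perm (Fin d)) (hg : ∀ p, x (g p) = x p)
    (hh : ∀ p, x (h p) = x p) :
    onB x (g * h) (fun p => by rw [Perm.mul_apply, hg, hh]) = onB x g hg * onB x h hh := by
  ext p
  simp only [Perm.mul_apply, onB_apply]
  by_cases hp : x p = 1
  · have hhp : x (h p) = 1 := by rw [hh, hp]
    simp [hp, hhp]
  · simp [hp]

/-- **The sign-certificate subgroup** of a colouring `x`: the `x`-invariant permutations acting EVENLY on the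
class `{x = 1}`. [folklore] -/
def certSubgroup (x : Fin d → ZMod 2) : Subgroup (Perm (Fin d)) where
  carrier := {g | ∃ hx : ∀ p, x (g p) = x p, sign (onB x g hx) = 1}
  one_mem' := ⟨fun _ => rfl, by rw [onB_one]; exact map_one _⟩
  mul_mem' := by
    rintro g h ⟨hg, hsg⟩ ⟨hh, hsh⟩
    refine ⟨fun p => by rw [Perm.mul_apply, hg, hh], ?_⟩
    rw [onB_mul x g h hg hh, map_mul, hsg, hsh, mul_one]
  inv_mem' := by
    rintro g ⟨hg, hsg⟩
    have hg' : ∀ p, x (g⁻¹ p) = x p := fun p => by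
      have h := hg (g.symm p)
      rw [Equiv.apply_symm_apply] at h
      exact h.symm
    refine ⟨hg', ?_⟩
    have hmul : onB x g hg * onB x g⁻¹ hg' = 1 := by
      rw [← onB_mul x g g⁻¹ hg hg']
      have : onB x (g * g⁻¹) (fun p => by rw [Perm.mul_apply, hg, hg']) = onB x 1 (fun _ => rfl) := by
        congr 1; exact mul_inv_cancel g
      rw [this, onB_one]
    have h1 := congrArg sign hmul
    rw [map_mul, map_one, hsg, one_mul] at h1
    exact h1

/-- Membership in the certificate subgroup, unfolded. [folklore] -/
theorem mem_certSubgroup_iff (x : Fin d → ZMod 2) (g : Perm (Fin d)) :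
    g ∈ certSubgroup x ↔ ∃ hx : ∀ p, x (g p) = x p, sign (onB x g hx) = 1 := Iff.rfl

/-- Cycle factors have non-empty support. [folklore] -/
theorem support_nonempty_of_mem_cycleFactorsFinset {g c : Perm (Fin d)} (hc : c ∈ g.cycleFactorsFinset) :
    c.support.Nonempty := by
  rw [Finset.nonempty_iff_ne_empty, Ne, support_eq_empty_iff]
  exact (mem_cycleFactorsFinset_iff.1 hc).1.ne_one

/-- The cycle-count row of `g`: the indicator of the least points of the cycles of `g`. [folklore] -/
def cycRow (g : Perm (Fin d)) : Fin d → ZMod 2 :=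
  ∑ c ∈ g.cycleFactorsFinset.attach, Pi.single (c.1.support.min' (support_nonempty_of_mem_cycleFactorsFinset c.2)) 1

/-- **The sign row** of `g`: indicator of the support plus indicator of the least points of the cycles; for an
`x`-invariant `g`, `sgnRow g ⬝ᵥ x` is the parity of `|supp g ∩ B| + #{cycles of g inside B}`, i.e. the sign
of `g` on `B = {x = 1}`. [folklore] -/
def sgnRow (g : Perm (Fin d)) : Fin d → ZMod 2 :=
  (fun p => if p ∈ g.support then 1 else 0) + cycRow g

/-! ### The sign test -/

/-- **The level-1 SIGN TEST** for the dual-PERM function `Z ↦ [τ ∉ ⟨σ_i : i ∉ Z⟩]` (`v i = true` means wire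
`i` is ON, i.e. generator `σ_i` is REMOVED): there is an `𝔽₂`-colouring `x` of the points, invariant under `τ`
and under every remaining generator, on whose class `{x = 1}` every remaining generator acts evenly and `τ` acts
oddly — written as an `𝔽₂`-LINEAR system in `x`. [folklore] -/
def SignTest {n : ℕ} (σ : Fin n → Perm (Fin d)) (τ : Perm (Fin d)) (v : Fin n → Bool) : Prop :=
  ∃ x : Fin d → ZMod 2, (∀ p, x (τ p) = x p) ∧ sgnRow τ ⬝ᵥ x = 1 ∧
    ∀ i, v i = false → (∀ p, x (σ i p) = x p) ∧ sgnRow (σ i) ⬝ᵥ x = 0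

variable {n : ℕ}

/-- The wire rows of the sign test: wire `i` owns the invariance rows `e_{σ_i p} + e_p` and the sign row
`sgnRow σ_i`. [folklore] -/
def wrow (σ : Fin n → Perm (Fin d)) : Fin n × (Fin d ⊕ Unit) → (Fin d → ZMod 2)
  | (i, Sum.inl p) => Pi.single (σ i p) 1 + Pi.single p 1
  | (i, Sum.inr _) => sgnRow (σ i)

/-- The constant rows of the sign test: the invariance rows `e_{τ p} + e_p` of the target. [folklore] -/
def crow (τ : Perm (Fin d)) : Set (Fin d → ZMod 2) :=
  Set.range fun p : Fin d => Pi.single (τ p) (1 : ZMod 2) + Pi.single p 1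

end Summit.PneNP.PneNP.Theorems.Capture.SignCert
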